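import Literature.AlgebraicGeometry.Motives.FrobIntegralPartTopIffFrobeniusSemisimple
import Literature.LinearAlgebra.Triangulable
import HarnessLib

/-!
# `F^r_b Hⁱ(X)` is the sum of the eigenspaces of the Frobenius for the eigenvalues `α` with `α/q^r`
# an algebraic integer (Milne–Ramachandran 2006, Rem. 1.4 — the case of eigenvalues in `K`)

Topic `Literature/AlgebraicGeometry/Motives`; THEOREMS ONLY (no definition, no instance, no named
fact; D-0026).

J. S. Milne, N. Ramachandran, *Motivic complexes over finite fields and the ring of correspondences at
the generic point*, arXiv:math/0607483 [MilneRamachandran2006] §1 Rem. 1.4 (held text, chunk p0003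
L77–L88): «Let `X` be a smooth complete variety over `k`. For any `i` and `r`, the set of eigenvalues
`α` of `ϖ_X` on `Hⁱ_l(X)` such that `α/q^r` is an algebraic integer is stable under Galois conjugation.
Therefore, there is a subspace `F^r_b Hⁱ_l(X)` of `Hⁱ_l(X)` that **becomes the sum of the eigenspaces
of these `α`** over `ℚ_l^{al}`. It is the largest semisimple Tate substructure of `Hⁱ_l(X)` whose
twist by `ℚ_l(r)` is still effective.»

The tree DEFINES `E.frobIntegralPart X i r = F^r_b Hⁱ(X)` by the last sentence (inside `K`, via monic
integer polynomials squarefree over `ℚ`; `Motives/GeneralizedTateConjecture`).  This file proves the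
FIRST description for the abstract `E : GaloisWeilCohomology k K χ` over a finite field `k`, for the
eigenvalues lying in `K` (`ϖ = E.frobAction X i = E.frobenius X i`, `q = Nat.card k`):

* §1 **each eigenspace `Hⁱ(X)_α` of `ϖ` with `α/q^r` an algebraic integer lies in `F^r_b Hⁱ(X)`**
  (`eigenspace_le_frobIntegralPart`; on it `ϖ_r = (q⁻¹)^r ϖ` is the scalar `α/q^r`, killed by a monic
  integer polynomial squarefree over `ℚ` — `exists_monic_squarefree_aeval_eq_zero_of_isIntegral`, the
  radical of an integral equation, row g39-#10), hence `⨆_{α/q^r ∈ ℤ̄} Hⁱ(X)_α ⊆ F^r_b Hⁱ(X)`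
  (`iSup_eigenspace_le_frobIntegralPart`);
* §2 conversely **an eigenvalue of `ϖ` with an eigenvector in `F^r_b Hⁱ(X)` has `α/q^r` an algebraic
  integer** (`isIntegral_of_eigenvector_mem_frobIntegralPart`, `X` smooth projective: one monic integer
  polynomial kills `ϖ_r` on `F_b`, row g39-#9);
* §3 **REM. 1.4, split case: if the characteristic polynomial of `ϖ` on `Hⁱ(X)` splits over `K`, then
  `F^r_b Hⁱ(X) = ⨆_{α : α/q^r ∈ ℤ̄} Hⁱ(X)_α`** (`frobIntegralPart_eq_iSup_eigenspace_of_splits`): `ϖ` is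
  semisimple on `F_b` (row g39-#9) with split minimal polynomial, so `F_b` is the sum of its
  eigenspaces (the tree's `iSup_maxGenEigenspace_eq_top_of_splits_minpoly` with Mathlib's
  `IsFinitelySemisimple.maxGenEigenspace_eq_eigenspace`), and §2 sorts the eigenvalues.
  -- TODO(general form): the printed statement over `ℚ_l^{al}` (base change of `F_b` and Galois
  descent of the eigenspace sum) is not formalised; only eigenvalues in `K` are treated.

HC is not touched.

## References

* [MilneRamachandran2006] J. S. Milne, N. Ramachandran, arXiv:math/0607483, §1 Rem. 1.4.
* [HoffmanKunze1971LinearAlgebra] K. Hoffman, R. Kunze, *Linear Algebra*, §6.8 Thm. 12 (primary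
  decomposition; the tree's `Literature/LinearAlgebra/Triangulable`).
* [Deligne1974] P. Deligne, *La conjecture de Weil. I*, Thm. (1.6).

## Provenance

Lane `lit-hodgefound` (summit `HodgeConjecture`, Track 2 foundations library, Layer B: motives),
seat `lit-hodgefound-p29` (literature-prover, generation 39, row g39-#13).
-/

noncomputable section

open Polynomial

universe u v

namespace Literature.AlgebraicGeometry.Motives

/-! ### §0 An algebraic integer of `K` satisfies a monic integral equation squarefree over `ℚ` -/

section Pure

/-- **An algebraic integer `β ∈ K` (`char K = 0`) is a root of a MONIC INTEGER polynomial that is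
SQUAREFREE over `ℚ`** — the radical of any monic integral equation of `β` (row g39-#10's
`exists_monic_squarefree_aeval_eq_zero_of_isSemisimple`, applied to the semisimple scalar endomorphism
`β` of the line `K`). [cite: MilneRamachandran2006, §1.1 and Rem. 1.4] -/
theorem exists_monic_squarefree_aeval_eq_zero_of_isIntegral {K : Type*} [Field K] [CharZero K]
    {β : K} (hβ : IsIntegral ℤ β) :
    ∃ Q : ℤ[X], Q.Monic ∧ Squarefree (Q.map (Int.castRingHom ℚ)) ∧
      aeval β (Q.map (Int.castRingHom K)) = 0 := by
  obtain ⟨P, hPm, hP⟩ := hβ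
  set φ : Module.End K K := algebraMap K (Module.End K K) β with hφ
  have hPK : aeval φ (P.map (Int.castRingHom K)) = 0 := by
    rw [hφ, aeval_algebraMap_apply, ← algebraMap_int_eq, aeval_map_algebraMap, aeval_def, hP,
      map_zero]
  have hss : φ.IsSemisimple := by
    refine Module.End.isSemisimple_of_squarefree_aeval_eq_zero (p := X - C β)
      (separable_X_sub_C (x := β)).squarefree ?_
    rw [map_sub, aeval_X, aeval_C, hφ, sub_self]
  obtain ⟨Q, hQm, hQs, hQ⟩ := exists_monic_squarefree_aeval_eq_zero_of_isSemisimple φ hss hPm hPK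
  refine ⟨Q, hQm, hQs, ?_⟩
  rw [hφ, aeval_algebraMap_apply] at hQ
  exact (map_eq_zero_iff _ (algebraMap K (Module.End K K)).injective).mp hQ

end Pure

namespace GaloisWeilCohomology

variable {k : Type u} [Field k] [Finite k] {K : Type v} [Field K] [CharZero K]
  {χ : Field.absoluteGaloisGroup k →* Kˣ} (E : GaloisWeilCohomology k K χ)
variable {d : ℕ} {X : SchemeOver k}

omit [CharZero K] in
/-- A polynomial in the restriction of an endomorphism to a stable subspace, on elements (private copy
of the tree's `coe_aeval_restrict_apply`, `HodgeTheory/AbelianVarietyCyclotomicAutomorphismIntegralFreeLattice`).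
[folklore] -/
private theorem coe_aeval_restrict_apply'' {V : Type*} [AddCommGroup V] [Module K V]
    {f : Module.End K V} {p : Submodule K V} (hf : ∀ x ∈ p, f x ∈ p) (P : K[X]) (v : p) :
    ((aeval (f.restrict hf) P) v : V) = aeval f P (v : V) := by
  induction P using Polynomial.induction_on' with
  | add P Q hP hQ => simp only [map_add, LinearMap.add_apply, Submodule.coe_add, hP, hQ]
  | monomial n a =>
    simp only [aeval_monomial, LinearMap.smul_apply, Submodule.coe_smul, ← Algebra.smul_def,
      Module.End.pow_restrict n hf, LinearMap.coe_restrict_apply]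

/-! ### §1 Eigenspaces with `α/q^r` an algebraic integer lie in `F^r_b Hⁱ(X)` -/

/-- On the eigenspace `Hⁱ(X)_α` of `ϖ`, `ϖ_r = (q⁻¹)^r ϖ` acts as the scalar `(q⁻¹)^r α`.
[cite: MilneRamachandran2006, §1 Rem. 1.4] -/
theorem smul_frobenius_apply_of_mem_eigenspace {i : ℕ} (r : ℕ) {α : K} {v : E.obj X i}
    (hv : v ∈ Module.End.eigenspace (E.frobAction X i) α) :
    (((Nat.card k : K)⁻¹ ^ r) • E.frobenius X i) v = (((Nat.card k : K)⁻¹ ^ r) * α) • v := by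
  rw [LinearMap.smul_apply, frobenius_eq_frobAction, Module.End.mem_eigenspace_iff.mp hv, smul_smul]

/-- **The eigenspace `Hⁱ(X)_α` is an effective-twist subspace for `r` when `α/q^r` is an algebraic
integer** (any `k`-scheme `X`): it is `ϖ`-stable and `ϖ_r` acts on it as the algebraic integer
`(q⁻¹)^r α`, a root of a monic integer polynomial squarefree over `ℚ`.
[cite: MilneRamachandran2006, §1 Rem. 1.4] -/
theorem isEffectiveTwistSubspace_eigenspace (X : SchemeOver k) (i r : ℕ) {α : K}
    (hα : IsIntegral ℤ (((Nat.card k : K)⁻¹ ^ r) * α)) :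
    E.IsEffectiveTwistSubspace X i r (Module.End.eigenspace (E.frobAction X i) α) := by
  obtain ⟨Q, hQm, hQs, hQ⟩ := exists_monic_squarefree_aeval_eq_zero_of_isIntegral hα
  refine ⟨fun v hv ↦ ?_, ⟨Q, hQm, hQs, fun v hv ↦ ?_⟩⟩
  · rw [Module.End.mem_eigenspace_iff] at hv ⊢
    rw [frobenius_eq_frobAction, hv, map_smul, hv]
  · by_cases hv0 : v = 0
    · rw [hv0, map_zero]
    · have hev : Module.End.HasEigenvector (((Nat.card k : K)⁻¹ ^ r) • E.frobenius X i)
          (((Nat.card k : K)⁻¹ ^ r) * α) v :=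
        ⟨Module.End.mem_eigenspace_iff.mpr (E.smul_frobenius_apply_of_mem_eigenspace r hv), hv0⟩
      rw [Module.End.aeval_apply_of_hasEigenvector hev, ← coe_aeval_eq_eval, hQ, zero_smul]

/-- **`Hⁱ(X)_α ⊆ F^r_b Hⁱ(X)` when `α/q^r` is an algebraic integer.** [cite: MilneRamachandran2006, §1 Rem. 1.4] -/
theorem eigenspace_le_frobIntegralPart (X : SchemeOver k) (i r : ℕ) {α : K}
    (hα : IsIntegral ℤ (((Nat.card k : K)⁻¹ ^ r) * α)) :
    Module.End.eigenspace (E.frobAction X i) α ≤ E.frobIntegralPart X i r :=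
  E.le_frobIntegralPart (E.isEffectiveTwistSubspace_eigenspace X i r hα)

/-- **`⨆_{α : α/q^r ∈ ℤ̄} Hⁱ(X)_α ⊆ F^r_b Hⁱ(X)`** (Rem. 1.4: the sum of the eigenspaces of the `α` with
`α/q^r` an algebraic integer — here those in `K`). [cite: MilneRamachandran2006, §1 Rem. 1.4] -/
theorem iSup_eigenspace_le_frobIntegralPart (X : SchemeOver k) (i r : ℕ) :
    ⨆ (α : K) (_ : IsIntegral ℤ (((Nat.card k : K)⁻¹ ^ r) * α)),
        Module.End.eigenspace (E.frobAction X i) α ≤ E.frobIntegralPart X i r :=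
  iSup₂_le fun _ hα ↦ E.eigenspace_le_frobIntegralPart X i r hα

/-! ### §2 Eigenvalues occurring in `F^r_b Hⁱ(X)` have `α/q^r` an algebraic integer -/

/-- **An eigenvalue `α` of `ϖ` with an eigenvector in `F^r_b Hⁱ(X)` has `α/q^r` an algebraic integer**
(`X` smooth projective): ONE monic integer polynomial `Q` kills `ϖ_r` on `F_b` (row g39-#9), and on the
eigenvector `Q(ϖ_r) v = Q((q⁻¹)^r α) v`. [cite: MilneRamachandran2006, §1 Rem. 1.4] -/
theorem isIntegral_of_eigenvector_mem_frobIntegralPart (hX : IsSmoothProjective d X) {i r : ℕ}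
    {α : K} {v : E.obj X i} (hv : v ∈ Module.End.eigenspace (E.frobAction X i) α) (hv0 : v ≠ 0)
    (hvF : v ∈ E.frobIntegralPart X i r) : IsIntegral ℤ (((Nat.card k : K)⁻¹ ^ r) * α) := by
  obtain ⟨Q, hQm, -, hQ⟩ := E.exists_monic_squarefree_aeval_eq_zero_on_frobIntegralPart hX i r
  have hev : Module.End.HasEigenvector (((Nat.card k : K)⁻¹ ^ r) • E.frobenius X i)
      (((Nat.card k : K)⁻¹ ^ r) * α) v :=
    ⟨Module.End.mem_eigenspace_iff.mpr (E.smul_frobenius_apply_of_mem_eigenspace r hv), hv0⟩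
  have h := hQ v hvF
  rw [Module.End.aeval_apply_of_hasEigenvector hev, smul_eq_zero] at h
  rcases h with h | h
  · refine ⟨Q, hQm, ?_⟩
    rwa [eval_map, ← algebraMap_int_eq] at h
  · exact (hv0 h).elim

/-- The eigenspaces of `ϖ` met by `F^r_b Hⁱ(X)`: `Hⁱ(X)_α ∩ F^r_b Hⁱ(X) ≠ 0 ⟹ α/q^r ∈ ℤ̄` (`X` smooth
projective). [cite: MilneRamachandran2006, §1 Rem. 1.4] -/
theorem isIntegral_of_eigenspace_inf_frobIntegralPart_ne_bot (hX : IsSmoothProjective d X) {i r : ℕ}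
    {α : K} (h : Module.End.eigenspace (E.frobAction X i) α ⊓ E.frobIntegralPart X i r ≠ ⊥) :
    IsIntegral ℤ (((Nat.card k : K)⁻¹ ^ r) * α) := by
  obtain ⟨v, hv, hv0⟩ := (Submodule.ne_bot_iff _).mp h
  exact E.isIntegral_of_eigenvector_mem_frobIntegralPart hX (Submodule.mem_inf.mp hv).1 hv0
    (Submodule.mem_inf.mp hv).2

/-! ### §3 Rem. 1.4 in the split case: `F^r_b Hⁱ(X) = ⨆_{α : α/q^r ∈ ℤ̄} Hⁱ(X)_α` -/

/-- **`F^r_b Hⁱ(X)` is the sum of its intersections with the eigenspaces of `ϖ` when the characteristic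
polynomial of `ϖ` splits over `K`** (`X` smooth projective): `ϖ` is semisimple on `F_b` (row g39-#9)
with split minimal polynomial, hence diagonalisable there.
[cite: MilneRamachandran2006, §1 Rem. 1.4] [cite: HoffmanKunze1971LinearAlgebra, §6.8 Thm. 12] -/
theorem frobIntegralPart_le_iSup_eigenspace_of_splits (hX : IsSmoothProjective d X) {i : ℕ}
    (hs : (haveI := E.finite_obj hX i; (E.frobAction X i).charpoly).Splits) (r : ℕ) :
    E.frobIntegralPart X i r ≤
      ⨆ (α : K) (_ : IsIntegral ℤ (((Nat.card k : K)⁻¹ ^ r) * α)),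
        Module.End.eigenspace (E.frobAction X i) α := by
  haveI := E.finite_obj hX i
  set W := E.frobIntegralPart X i r with hW
  have hWst : ∀ x ∈ W, E.frobAction X i x ∈ W :=
    fun x hx ↦ by rw [← frobenius_eq_frobAction]; exact E.frobenius_mem_frobIntegralPart hx
  set g := (E.frobAction X i).restrict hWst with hg
  -- `g` is semisimple with split minimal polynomial
  have hgss : Module.End.IsSemisimple g := by
    have h := E.isSemisimple_restrict_frobenius_frobIntegralPart hX i r
    have heq : (E.frobenius X i).restrict
        (fun _ hx ↦ E.frobenius_mem_frobIntegralPart hx :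
          ∀ x ∈ E.frobIntegralPart X i r, E.frobenius X i x ∈ E.frobIntegralPart X i r) = g := by
      ext ⟨v, hv⟩; simp only [LinearMap.coe_restrict_apply, hg, frobenius_eq_frobAction]
    rwa [heq] at h
  have hmin_f : (minpoly K (E.frobAction X i)).Splits :=
    hs.of_dvd (LinearMap.charpoly_monic _).ne_zero (LinearMap.minpoly_dvd_charpoly _)
  have hmin_g : (minpoly K g).Splits := by
    refine hmin_f.of_dvd (minpoly.ne_zero (Algebra.IsIntegral.isIntegral _)) (minpoly.dvd K g ?_)
    ext ⟨v, hv⟩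
    rw [LinearMap.zero_apply, Submodule.coe_zero, hg, coe_aeval_restrict_apply'', minpoly.aeval,
      LinearMap.zero_apply]
  -- `W = ⊕ eigenspaces of g`
  have htop : ⨆ μ : K, Module.End.eigenspace g μ = ⊤ := by
    have h := Literature.LinearAlgebra.iSup_maxGenEigenspace_eq_top_of_splits_minpoly g hmin_g
    simpa only
      [(Module.End.isFinitelySemisimple_iff_isSemisimple.mpr hgss).maxGenEigenspace_eq_eigenspace]
      using h
  -- push the decomposition into `Hⁱ(X)`
  have hWeq : W = (⨆ μ : K, Module.End.eigenspace g μ).map W.subtype := by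
    rw [htop, Submodule.map_top, Submodule.range_subtype]
  rw [hWeq, Submodule.map_iSup]
  refine iSup_le fun μ ↦ ?_
  -- the image of `eigenspace g μ` lies in `eigenspace ϖ μ ∩ W`
  by_cases hμ : Module.End.eigenspace g μ = ⊥
  · rw [hμ, Submodule.map_bot]; exact bot_le
  · obtain ⟨w, hw, hw0⟩ := (Submodule.ne_bot_iff _).mp hμ
    have hwev : (w : E.obj X i) ∈ Module.End.eigenspace (E.frobAction X i) μ := by
      rw [Module.End.mem_eigenspace_iff] at hw ⊢
      simpa only [hg, LinearMap.coe_restrict_apply, Submodule.coe_smul] using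
        congrArg (fun y : W ↦ (y : E.obj X i)) hw
    have hint : IsIntegral ℤ (((Nat.card k : K)⁻¹ ^ r) * μ) :=
      E.isIntegral_of_eigenvector_mem_frobIntegralPart hX hwev
        (fun h ↦ hw0 (Subtype.ext h)) w.2
    refine le_trans ?_ (le_iSup₂_of_le μ hint le_rfl)
    rintro _ ⟨y, hy, rfl⟩
    replace hy : y ∈ Module.End.eigenspace g μ := hy
    rw [Module.End.mem_eigenspace_iff] at hy ⊢
    simpa only [hg, LinearMap.coe_restrict_apply, Submodule.coe_smul, Submodule.coe_subtype] using
      congrArg (fun y : W ↦ (y : E.obj X i)) hy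

/-- **REM. 1.4 (eigenvalues in `K`): if the characteristic polynomial of the Frobenius on `Hⁱ(X)` splits
over `K`, then `F^r_b Hⁱ(X)` is the sum of the eigenspaces `Hⁱ(X)_α` of `ϖ` over the eigenvalues `α`
with `α/q^r` an algebraic integer** (`X` smooth projective over `𝔽_q`).
-- TODO(general form): over `ℚ_l^{al}` («becomes the sum … over `ℚ_l^{al}`»): base change + descent.
[cite: MilneRamachandran2006, §1 Rem. 1.4] -/
theorem frobIntegralPart_eq_iSup_eigenspace_of_splits (hX : IsSmoothProjective d X) {i : ℕ}
    (hs : (haveI := E.finite_obj hX i; (E.frobAction X i).charpoly).Splits) (r : ℕ) :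
    E.frobIntegralPart X i r =
      ⨆ (α : K) (_ : IsIntegral ℤ (((Nat.card k : K)⁻¹ ^ r) * α)),
        Module.End.eigenspace (E.frobAction X i) α :=
  le_antisymm (E.frobIntegralPart_le_iSup_eigenspace_of_splits hX hs r)
    (E.iSup_eigenspace_le_frobIntegralPart X i r)

/-- **`r = 0`, split case: `F^0_b Hⁱ(X) = ⨆_{α ∈ ℤ̄} Hⁱ(X)_α`**, the sum of the eigenspaces of `ϖ` at its
algebraic-integer eigenvalues. [cite: MilneRamachandran2006, §1.1 and Rem. 1.4] -/
theorem frobIntegralPart_zero_eq_iSup_eigenspace_of_splits (hX : IsSmoothProjective d X) {i : ℕ}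
    (hs : (haveI := E.finite_obj hX i; (E.frobAction X i).charpoly).Splits) :
    E.frobIntegralPart X i 0 =
      ⨆ (α : K) (_ : IsIntegral ℤ α), Module.End.eigenspace (E.frobAction X i) α := by
  rw [E.frobIntegralPart_eq_iSup_eigenspace_of_splits hX hs 0]
  simp only [pow_zero, one_mul]

end GaloisWeilCohomology

end Literature.AlgebraicGeometry.Motives

end
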